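import Summits.HodgeConjecture.HodgeCM.Model.AdelicThetaDistribution
import HarnessLib

/-!
# FLOOR-0 P4, seat S4b(ii) — `D.dist f Φ_f ≠ 0` ⟺ some weight-`ℓ` theta lift `Θ_{Φ_∞(ℓ) ⊗ Φ_f}(f)` is non-zero

Cell hodgecm-mathlib (D-0151), FLOOR 0, crux item H413 = stmt-HodgeConjecture-24833; programme P4, line
`Cruxes/H413/Lines/F0_P4AdmissibleOccursInH1.lean` ED. 2, stub S4b `stub_T3a_holThetaAtAdmissibleLineOfRallisAt`; PLAN-F0P4 v2 §5.3
«the closing lemma hR → (A) → (FIN) → ∃ Φ_f, D.dist (charInv χ̃) Φ_f ≠ 0».  Namespace `Summit.HodgeConjecture.HodgeConjecture.Cruxes.H413.ThetaNonvanishing`.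
`--supports stmt-HodgeConjecture-24833 --as helper`.  DEF-FREE (theorems only), generic over the model's `ThetaDistDatum`.

The capstone ★ `Theorems/H413HolRealOfTransport.exists_holReal_of_transport` wants `hne : ∃ Φ_f, D.dist (charInv χ̃) Φ_f ≠ 0` for a product
theta-distribution datum `D` of the model (`HodgeCM/Model/AdelicThetaDistribution`: `D.dist f : 𝒮((𝔸_{L⁺}^∞)³) →ₗ (G_U(𝔸) → ℂ²)`,
`ℓ (D.dist f Φ_f g) = Θ̃_{Φarch ℓ ⊗ Φ_f}(f)(g)`, ★ `apply_dist`), while every non-vanishing engine of the tree speaks about theta LIFTS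
`ThetaKernelDatum.thetaLift μ Φ f ∈ C([G_U], ℂ)` (S6 = [Li1992, Thm 2.1] through ★ `RallisInnerProductIdentity.thetaLift_ne_zero_of_re_pos`,
★ `Li1992/RallisInnerProductCharacterLift`, ★ `Theorems/H413ThetaPairRepArchFinFactorisation`, and the J-R transport ★
`Theorems/H413RallisTransport.kernelDatum_thetaLift_ne_zero_iff(_canonical)` whose left-hand side is `P.kernelDatum.thetaLift μ' (toThetaTop Φ) f' ≠ 0`).
This file is the (trivial, but typed once) dictionary between the two:

* `dist_apply_eq_zero_iff` — `D.dist f Φ_f g = 0 ↔ ∀ ℓ, Θ̃_{Φarch ℓ ⊗ Φ_f}(f)(g) = 0` (the dual of `ℂ²` separates points);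
* **`dist_eq_zero_iff_forall_thetaLift`** — `D.dist f Φ_f = 0 ↔ ∀ ℓ, (S.P k).kernelDatum.thetaLift μ_{[U(1)]} (D.fam Φ_f ℓ) f = 0`;
* **`dist_ne_zero_of_thetaLift_ne_zero`** — ONE non-zero lift `Θ_{Φarch ℓ ⊗ Φ_f}(f) ≠ 0` gives `D.dist f Φ_f ≠ 0`, and `exists_dist_ne_zero_iff`;
* `fam_eq_toThetaTop` — `D.fam Φ_f ℓ = (S.P k).weilDatum.toThetaTop (piSchwartzBruhatEquiv (Φarch ℓ ⊗ Φ_f))`, the spelling of ★ J-R's left-hand side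
  (`P := S.P k`, `Φ := piSchwartzBruhatEquiv (D.Φarch ℓ ⊗ₜ Φ_f)`, `f' := charInv χ̃`).
So `hne` ⟸ «`Θ_{Φarch ℓ ⊗ Φ_f}(charInv χ̃) ≠ 0` for one `(ℓ, Φ_f)`» ⟸ (J-R ★) the transported lift of S6's unitary dual pair is non-zero ⟸
(★ `thetaLift_charCM_tmul_ne_zero_of_finCoeff_ne_zero`) `hR` (S6) ∧ `heig` (A) ∧ `hfin` (FIN).
HC_CM is proved only modulo the printed citations until rung 0 closes; this file proves nothing about them.

## References
* [Liu2021] Y. Liu, Camb. J. Math. 9 (2021) = arXiv:2102.11518, proof of Prop. 4.13 (l. 2145), App. D §D.1 Step 3 (l. 5219–5221).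
* [Li1992] J.-S. Li, J. reine angew. Math. 428 (1992), p. 178 («`θ^f_φ ≠ 0` iff its Petersson norm is») and Thm 2.1 p. 184.
* [FleigEtAl2018] P. Fleig, H. Gustafsson, A. Kleinschmidt, D. Persson, *Eisenstein series and automorphic representations* (2018), §12.3 (12.37).
-/

set_option autoImplicit false
set_option linter.dupNamespace false

noncomputable section

open NumberField hiding relNormOneIdeles relNormOneRat probHaarRelNormOneQuot
open scoped TensorProduct
open Literature.NumberTheory.Automorphic Literature.NumberTheory.Weil1964
open HodgeCM HodgeCM.Model HodgeCM.Model.ThetaAdelicSide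

namespace Summit.HodgeConjecture.HodgeConjecture.Cruxes.H413.ThetaNonvanishing

variable {L : HodgeCM.CMField} {ι₁ : L →+* ℂ} {V : HodgeCM.HermSpace3 L ι₁} {c : SeesawCtx L} {S : ThetaAdelicSide V c}
  {hV : IsAnisotropic L (HodgeCM.HermSpace3.Hm V)} {k : Fin 4} (D : S.ThetaDistDatum hV k)
  (f : C(↥(relNormOneIdeles (↥(maximalRealSubfield L)) (L : Type)) ⧸ relNormOneRat (↥(maximalRealSubfield L)) (L : Type), ℂ))
  (Φf : FinSB (↥(maximalRealSubfield L)) (Fin 3))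

/-- `D.fam Φ_f ℓ` IS the `Θ`-top reading of `Φarch ℓ ⊗ Φ_f` (the `Φ`-slot of ★ `H413RallisTransport.kernelDatum_thetaLift_ne_zero_iff`).
[cite: Liu2021, proof of Prop. 4.13 (l. 2145)] -/
theorem fam_eq_toThetaTop (ℓ : Module.Dual ℂ (Fin 2 → ℂ)) :
    D.fam Φf ℓ = (S.P k).weilDatum.toThetaTop (piSchwartzBruhatEquiv (↥(maximalRealSubfield L)) (Fin 3) (D.Φarch ℓ ⊗ₜ[ℂ] Φf)) :=
  D.fam_apply Φf ℓ

/-- **pointwise**: `D.dist f Φ_f g = 0 ↔ ∀ ℓ, Θ̃_{Φarch ℓ ⊗ Φ_f}(f)(g) = 0` (★ `apply_dist`; the dual of `ℂ²` separates points).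
[cite: Liu2021, proof of Prop. 4.13 (l. 2145)] -/
theorem dist_apply_eq_zero_iff (g : (V.latticeModel printFact_unitaryCompact_holds).G) :
    D.dist f Φf g = 0 ↔ ∀ ℓ : Module.Dual ℂ (Fin 2 → ℂ),
      (S.P k).kernelDatum.thetaLiftFun (probHaarRelNormOneQuot (↥(maximalRealSubfield L)) (L : Type)) (D.fam Φf ℓ) f g = 0 := by
  constructor
  · intro h ℓ
    rw [← D.apply_dist, h, map_zero]
  · intro h
    refine (Module.forall_dual_apply_eq_zero_iff ℂ _).1 fun ℓ => ?_
    rw [D.apply_dist]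
    exact h ℓ

/-- **`D.dist f Φ_f = 0 ↔ every weight-`ℓ` theta lift `Θ_{Φarch ℓ ⊗ Φ_f}(f) ∈ C([G_U], ℂ)` vanishes.**
[cite: Li1992, p. 178] [cite: FleigEtAl2018, §12.3 (12.37)] -/
theorem dist_eq_zero_iff_forall_thetaLift :
    D.dist f Φf = 0 ↔ ∀ ℓ : Module.Dual ℂ (Fin 2 → ℂ),
      (S.P k).kernelDatum.thetaLift (probHaarRelNormOneQuot (↥(maximalRealSubfield L)) (L : Type)) (D.fam Φf ℓ) f = 0 := by
  constructor
  · intro h ℓ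
    ext ξ
    induction ξ using QuotientGroup.induction_on with
    | H x =>
      have hx := (dist_apply_eq_zero_iff D f Φf x⁻¹).1 (by rw [h]; rfl) ℓ
      rw [ThetaKernelDatum.thetaLiftFun_apply, inv_inv] at hx
      rw [hx, ContinuousMap.zero_apply]
  · intro h
    funext g
    rw [Pi.zero_apply]
    exact (dist_apply_eq_zero_iff D f Φf g).2 fun ℓ => by rw [ThetaKernelDatum.thetaLiftFun_apply, h ℓ, ContinuousMap.zero_apply]

/-- **ONE non-zero theta lift suffices**: `Θ_{Φarch ℓ ⊗ Φ_f}(f) ≠ 0 ⟹ D.dist f Φ_f ≠ 0`. [cite: Li1992, p. 178] [cite: Liu2021, proof of Prop. 4.13 (l. 2145)] -/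
theorem dist_ne_zero_of_thetaLift_ne_zero {ℓ : Module.Dual ℂ (Fin 2 → ℂ)}
    (h : (S.P k).kernelDatum.thetaLift (probHaarRelNormOneQuot (↥(maximalRealSubfield L)) (L : Type)) (D.fam Φf ℓ) f ≠ 0) :
    D.dist f Φf ≠ 0 := fun h0 =>
  h ((dist_eq_zero_iff_forall_thetaLift D f Φf).1 h0 ℓ)

/-- the converse: `D.dist f Φ_f ≠ 0 ⟹ ∃ ℓ, Θ_{Φarch ℓ ⊗ Φ_f}(f) ≠ 0`. [cite: Li1992, p. 178] -/
theorem exists_thetaLift_ne_zero_of_dist_ne_zero (h : D.dist f Φf ≠ 0) :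
    ∃ ℓ : Module.Dual ℂ (Fin 2 → ℂ),
      (S.P k).kernelDatum.thetaLift (probHaarRelNormOneQuot (↥(maximalRealSubfield L)) (L : Type)) (D.fam Φf ℓ) f ≠ 0 := by
  by_contra hc
  exact h ((dist_eq_zero_iff_forall_thetaLift D f Φf).2 fun ℓ => not_not.1 fun hℓ => hc ⟨ℓ, hℓ⟩)

/-- **the `hne` row of ★ `exists_holReal_of_transport`, in theta-LIFT currency**:
`(∃ Φ_f, D.dist f Φ_f ≠ 0) ↔ ∃ Φ_f ℓ, Θ_{Φarch ℓ ⊗ Φ_f}(f) ≠ 0`. [cite: Liu2021, proof of Prop. 4.13 (l. 2145); App. D §D.1 Step 3 (l. 5219–5221)] -/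
theorem exists_dist_ne_zero_iff :
    (∃ Φf : FinSB (↥(maximalRealSubfield L)) (Fin 3), D.dist f Φf ≠ 0) ↔
      ∃ (Φf : FinSB (↥(maximalRealSubfield L)) (Fin 3)) (ℓ : Module.Dual ℂ (Fin 2 → ℂ)),
        (S.P k).kernelDatum.thetaLift (probHaarRelNormOneQuot (↥(maximalRealSubfield L)) (L : Type)) (D.fam Φf ℓ) f ≠ 0 :=
  ⟨fun ⟨Φf, h⟩ => ⟨Φf, exists_thetaLift_ne_zero_of_dist_ne_zero D f Φf h⟩,
    fun ⟨Φf, _, h⟩ => ⟨Φf, dist_ne_zero_of_thetaLift_ne_zero D f Φf h⟩⟩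

/-- the same with the lift read through `toThetaTop (piSchwartzBruhatEquiv (Φarch ℓ ⊗ Φ_f))` — literally the left-hand side of ★
`H413RallisTransport.kernelDatum_thetaLift_ne_zero_iff_canonical` with `P := S.P k`. [cite: Liu2021, proof of Prop. 4.13 (l. 2145)] -/
theorem dist_ne_zero_of_thetaLift_toThetaTop_ne_zero {ℓ : Module.Dual ℂ (Fin 2 → ℂ)}
    (h : (S.P k).kernelDatum.thetaLift (probHaarRelNormOneQuot (↥(maximalRealSubfield L)) (L : Type))
      ((S.P k).weilDatum.toThetaTop (piSchwartzBruhatEquiv (↥(maximalRealSubfield L)) (Fin 3) (D.Φarch ℓ ⊗ₜ[ℂ] Φf))) f ≠ 0) :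
    D.dist f Φf ≠ 0 :=
  dist_ne_zero_of_thetaLift_ne_zero D f Φf (ℓ := ℓ) (by rwa [fam_eq_toThetaTop])

end Summit.HodgeConjecture.HodgeConjecture.Cruxes.H413.ThetaNonvanishing

end
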